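import Literature.MathematicalPhysics.StatisticalMechanics.LennardJonesClusters

/-!
# Route `ExcessDecayLiouville`: far-field lattice-sum bounds over separated point sets

The "exterior matter acts only through a force `O(s⁻⁴)` at depth `s`" step of item `ExcessDecay`
(stmt-AtomisticToContinuum-9334) and the "far field `Σ_{|q−p| ≥ L} |V′| ≤ C L⁻⁴` uniformly by separation"
step of `GrainsGlue` both rest on one elementary estimate: for a `δ`-separated point set in `ℝ³` and a
centre `p`, the inverse-power sum over the points at distance `≥ R ≥ δ` from `p` obeys

`Σ_{a : R ≤ |a − p|} |a − p|^{-(k+3)} ≤ 1024 / (δ³ Rᵏ)`   (`k ≥ 1`),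

by dyadic shells: the shell `R 2ⁿ ≤ |a − p| < R 2ⁿ⁺¹` holds at most `(8 R 2ⁿ/δ)³` points
(`card_le_of_separated_of_dist_le`, packing by volume) each contributing `≤ (R 2ⁿ)^{-(k+3)}`, and
`Σₙ 512 δ⁻³ (R 2ⁿ)^{-k} ≤ 1024 δ⁻³ R^{-k}`.  We prove the finite-set form
(`sum_inv_pow_le_of_separated`) and deduce summability with the same bound for arbitrary separated
sets (`summable_inv_pow_of_separated`, `tsum_inv_pow_le_of_separated`).  With `k = 4` this is the
`r⁻⁷` force tail (`V′_LJ(r) = −r⁻¹³ + r⁻⁷`), with `k = 3` the `r⁻⁶` energy tail, with `k = 5` the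
`r⁻⁸` force-constant tail.  All `[folklore]`; helper lemmas, nothing here closes an item.
-/

noncomputable section

namespace Summit.AtomisticToContinuum.Crystallization.Theorems.ExcessDecayLiouville

open scoped BigOperators Topology
open Literature.MathematicalPhysics.StatisticalMechanics

/-- One dyadic shell: a `δ`-separated finite set in `R·2ⁿ ≤ dist · p < R·2ⁿ⁺¹` (`0 < δ ≤ R`) has
inverse-power sum `Σ |a − p|^{-(k+3)} ≤ 512/(δ³ Rᵏ) · (1/2)ⁿ` for `k ≥ 1`. [folklore] -/
theorem sum_inv_pow_le_of_separated_shell (F : Finset (EuclideanSpace ℝ (Fin 3))) (p : (EuclideanSpace ℝ (Fin 3))) {δ R : ℝ} {k : ℕ} (n : ℕ)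
    (hk : 1 ≤ k) (hδ : 0 < δ) (hδR : δ ≤ R)
    (hsep : ∀ a ∈ F, ∀ b ∈ F, a ≠ b → δ ≤ dist a b)
    (hlo : ∀ a ∈ F, R * 2 ^ n ≤ dist a p) (hhi : ∀ a ∈ F, dist a p ≤ R * 2 ^ (n + 1)) :
    ∑ a ∈ F, (dist a p)⁻¹ ^ (k + 3) ≤ 512 / (δ ^ 3 * R ^ k) * (1 / 2) ^ n := by
  have hRpos : 0 < R := hδ.trans_le hδR
  set M : ℝ := R * 2 ^ n with hM
  have h2n : (1 : ℝ) ≤ 2 ^ n := one_le_pow₀ (by norm_num)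
  have hMpos : 0 < M := by positivity
  have hRM : R ≤ M := by
    calc R = R * 1 := (mul_one R).symm
      _ ≤ R * 2 ^ n := by gcongr
  -- (1) cardinality by packing
  have hcard : (F.card : ℝ) ≤ (2 * (R * 2 ^ (n + 1)) / δ + 1) ^ 3 := by
    have h := card_le_of_separated_of_dist_le F p hδ (by positivity : (0 : ℝ) ≤ R * 2 ^ (n + 1))
      hhi hsep
    rwa [finrank_euclideanSpace_fin] at h
  have hcard' : (F.card : ℝ) ≤ 512 * M ^ 3 / δ ^ 3 := by
    refine hcard.trans ?_
    have hq : 2 * (R * 2 ^ (n + 1)) / δ + 1 ≤ 8 * M / δ := by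
      have hRM2 : R * 2 ^ (n + 1) = M * 2 := by rw [hM, pow_succ]; ring
      rw [hRM2]
      have h1 : 1 ≤ 4 * M / δ := by
        rw [le_div_iff₀ hδ]; linarith
      calc 2 * (M * 2) / δ + 1 ≤ 2 * (M * 2) / δ + 4 * M / δ := by linarith
        _ = 8 * M / δ := by ring
    have h0 : 0 ≤ 2 * (R * 2 ^ (n + 1)) / δ + 1 := by positivity
    calc (2 * (R * 2 ^ (n + 1)) / δ + 1) ^ 3 ≤ (8 * M / δ) ^ 3 := pow_le_pow_left₀ h0 hq 3
      _ = 512 * M ^ 3 / δ ^ 3 := by ring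
  -- (2) each term
  have hterm : ∀ a ∈ F, (dist a p)⁻¹ ^ (k + 3) ≤ (M⁻¹) ^ (k + 3) := by
    intro a ha
    have hlo' := hlo a ha
    have hdpos : 0 < dist a p := hMpos.trans_le hlo'
    exact pow_le_pow_left₀ (inv_nonneg.2 hdpos.le) (inv_anti₀ hMpos hlo') _
  -- (3) combine
  have hsum : ∑ a ∈ F, (dist a p)⁻¹ ^ (k + 3) ≤ F.card * (M⁻¹) ^ (k + 3) := by
    have := Finset.sum_le_card_nsmul F (fun a => (dist a p)⁻¹ ^ (k + 3)) _ hterm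
    rwa [nsmul_eq_mul] at this
  have hMk : (M⁻¹) ^ k ≤ (R⁻¹) ^ k * (1 / 2) ^ n := by
    have h1 : ((2 : ℝ) ^ n)⁻¹ ^ k ≤ ((2 : ℝ) ^ n)⁻¹ :=
      pow_le_of_le_one (inv_nonneg.2 (by positivity)) (inv_le_one_of_one_le₀ h2n) (by omega)
    have h2 : (1 / 2 : ℝ) ^ n = ((2 : ℝ) ^ n)⁻¹ := by rw [one_div, inv_pow]
    rw [h2, hM, mul_inv, mul_pow]
    gcongr
  have hnonneg : 0 ≤ (M⁻¹) ^ (k + 3) := by positivity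
  calc ∑ a ∈ F, (dist a p)⁻¹ ^ (k + 3) ≤ F.card * (M⁻¹) ^ (k + 3) := hsum
    _ ≤ 512 * M ^ 3 / δ ^ 3 * (M⁻¹) ^ (k + 3) := by gcongr
    _ = 512 / δ ^ 3 * (M⁻¹) ^ k := by
      have hM3 : M ^ 3 * (M⁻¹) ^ 3 = 1 := by rw [inv_pow, mul_inv_cancel₀ (by positivity)]
      rw [pow_add]
      calc 512 * M ^ 3 / δ ^ 3 * ((M⁻¹) ^ k * (M⁻¹) ^ 3)
          = 512 / δ ^ 3 * (M⁻¹) ^ k * (M ^ 3 * (M⁻¹) ^ 3) := by ring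
        _ = 512 / δ ^ 3 * (M⁻¹) ^ k := by rw [hM3, mul_one]
    _ ≤ 512 / δ ^ 3 * ((R⁻¹) ^ k * (1 / 2) ^ n) := by gcongr
    _ = 512 / (δ ^ 3 * R ^ k) * (1 / 2) ^ n := by
      rw [inv_pow]; field_simp

/-- **Far-field inverse-power sums over separated sets (finite form).**  If the finite set `s ⊂ ℝ³` is
`δ`-separated and all its points are at distance `≥ R ≥ δ > 0` from `p`, then for `k ≥ 1`
`Σ_{a ∈ s} |a − p|^{-(k+3)} ≤ 1024 / (δ³ Rᵏ)` (dyadic shells + packing). [folklore] -/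
theorem sum_inv_pow_le_of_separated (s : Finset (EuclideanSpace ℝ (Fin 3))) (p : (EuclideanSpace ℝ (Fin 3))) {δ R : ℝ} {k : ℕ} (hk : 1 ≤ k)
    (hδ : 0 < δ) (hδR : δ ≤ R)
    (hsep : ∀ a ∈ s, ∀ b ∈ s, a ≠ b → δ ≤ dist a b) (hfar : ∀ a ∈ s, R ≤ dist a p) :
    ∑ a ∈ s, (dist a p)⁻¹ ^ (k + 3) ≤ 1024 / (δ ^ 3 * R ^ k) := by
  classical
  have hRpos : 0 < R := hδ.trans_le hδR
  have key : ∀ a ∈ s, ∃ n : ℕ, R * 2 ^ n ≤ dist a p ∧ dist a p ≤ R * 2 ^ (n + 1) := by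
    intro a ha
    have h1 : 1 ≤ dist a p / R := by
      rw [le_div_iff₀ hRpos, one_mul]; exact hfar a ha
    obtain ⟨n, hn, hn'⟩ := exists_nat_pow_near h1 one_lt_two
    refine ⟨n, ?_, ?_⟩
    · rw [le_div_iff₀ hRpos] at hn; linarith
    · rw [div_lt_iff₀ hRpos] at hn'; linarith
  choose! idx hidx using key
  have hmaps : ∀ a ∈ s, idx a ∈ s.image idx := fun a ha => Finset.mem_image_of_mem idx ha
  rw [← Finset.sum_fiberwise_of_maps_to hmaps]
  have hC : 0 ≤ 512 / (δ ^ 3 * R ^ k) := by positivity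
  have fiber : ∀ n ∈ s.image idx,
      ∑ a ∈ s with idx a = n, (dist a p)⁻¹ ^ (k + 3) ≤ 512 / (δ ^ 3 * R ^ k) * (1 / 2) ^ n := by
    intro n _
    refine sum_inv_pow_le_of_separated_shell _ p n hk hδ hδR ?_ ?_ ?_
    · intro a ha b hb hab
      exact hsep a (Finset.mem_filter.1 ha).1 b (Finset.mem_filter.1 hb).1 hab
    · intro a ha
      obtain ⟨ha', hn⟩ := Finset.mem_filter.1 ha
      rw [← hn]
      exact (hidx a ha').1
    · intro a ha
      obtain ⟨ha', hn⟩ := Finset.mem_filter.1 ha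
      rw [← hn]
      exact (hidx a ha').2
  have hgeom : HasSum (fun n : ℕ => 512 / (δ ^ 3 * R ^ k) * (1 / 2 : ℝ) ^ n)
      (512 / (δ ^ 3 * R ^ k) * 2) := by
    have h := hasSum_geometric_two
    exact h.mul_left _
  calc ∑ n ∈ s.image idx, ∑ a ∈ s with idx a = n, (dist a p)⁻¹ ^ (k + 3)
      ≤ ∑ n ∈ s.image idx, 512 / (δ ^ 3 * R ^ k) * (1 / 2 : ℝ) ^ n := Finset.sum_le_sum fiber
    _ ≤ 512 / (δ ^ 3 * R ^ k) * 2 :=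
        sum_le_hasSum _ (fun n _ => by positivity) hgeom
    _ = 1024 / (δ ^ 3 * R ^ k) := by ring

/-- **Far-field inverse-power sums over separated sets (summable form).**  For a `δ`-separated set
`X ⊂ ℝ³`, a centre `p`, `0 < δ ≤ R` and `k ≥ 1`, the family `a ↦ |a − p|^{-(k+3)}` over the points of
`X` at distance `≥ R` from `p` is summable. [folklore] -/
theorem summable_inv_pow_of_separated {X : Set (EuclideanSpace ℝ (Fin 3))} (p : (EuclideanSpace ℝ (Fin 3))) {δ R : ℝ} {k : ℕ} (hk : 1 ≤ k)
    (hδ : 0 < δ) (hδR : δ ≤ R) (hsep : ∀ a ∈ X, ∀ b ∈ X, a ≠ b → δ ≤ dist a b) :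
    Summable (fun a : {a : (EuclideanSpace ℝ (Fin 3)) // a ∈ X ∧ R ≤ dist a p} => (dist (a : (EuclideanSpace ℝ (Fin 3))) p)⁻¹ ^ (k + 3)) := by
  refine summable_of_sum_le (fun _ => by positivity) (c := 1024 / (δ ^ 3 * R ^ k)) fun u => ?_
  have h := sum_inv_pow_le_of_separated (u.map (Function.Embedding.subtype _)) p hk hδ hδR ?_ ?_
  · rwa [Finset.sum_map] at h
  · intro a ha b hb hab
    simp only [Finset.mem_map, Function.Embedding.coe_subtype] at ha hb
    obtain ⟨a', -, rfl⟩ := ha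
    obtain ⟨b', -, rfl⟩ := hb
    exact hsep _ a'.2.1 _ b'.2.1 hab
  · intro a ha
    simp only [Finset.mem_map, Function.Embedding.coe_subtype] at ha
    obtain ⟨a', -, rfl⟩ := ha
    exact a'.2.2

/-- **Far-field inverse-power sums over separated sets (`tsum` bound).**  In the situation of
`summable_inv_pow_of_separated`, `∑' |a − p|^{-(k+3)} ≤ 1024 / (δ³ Rᵏ)`. [folklore] -/
theorem tsum_inv_pow_le_of_separated {X : Set (EuclideanSpace ℝ (Fin 3))} (p : (EuclideanSpace ℝ (Fin 3))) {δ R : ℝ} {k : ℕ} (hk : 1 ≤ k)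
    (hδ : 0 < δ) (hδR : δ ≤ R) (hsep : ∀ a ∈ X, ∀ b ∈ X, a ≠ b → δ ≤ dist a b) :
    ∑' a : {a : (EuclideanSpace ℝ (Fin 3)) // a ∈ X ∧ R ≤ dist a p}, (dist (a : (EuclideanSpace ℝ (Fin 3))) p)⁻¹ ^ (k + 3) ≤ 1024 / (δ ^ 3 * R ^ k) := by
  refine (summable_inv_pow_of_separated p hk hδ hδR hsep).tsum_le_of_sum_le fun u => ?_
  have h := sum_inv_pow_le_of_separated (u.map (Function.Embedding.subtype _)) p hk hδ hδR ?_ ?_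
  · rwa [Finset.sum_map] at h
  · intro a ha b hb hab
    simp only [Finset.mem_map, Function.Embedding.coe_subtype] at ha hb
    obtain ⟨a', -, rfl⟩ := ha
    obtain ⟨b', -, rfl⟩ := hb
    exact hsep _ a'.2.1 _ b'.2.1 hab
  · intro a ha
    simp only [Finset.mem_map, Function.Embedding.coe_subtype] at ha
    obtain ⟨a', -, rfl⟩ := ha
    exact a'.2.2

end Summit.AtomisticToContinuum.Crystallization.Theorems.ExcessDecayLiouville

end
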